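import Literature.MathematicalPhysics.KineticTheory.ReyBelletThomas2002Semigroup
import Literature.MathematicalPhysics.KineticTheory.ReyBelletThomas2002SmoothDensity
import Literature.MathematicalPhysics.KineticTheory.ConfinedBackwardEquation
import HarnessLib

/-!
# Rey-Bellet–Thomas 2002: the time-reversed effective dynamics and the duality of the transition kernels

Trunk T-KINETIC (Literature/MathematicalPhysics/KineticTheory). Inline decomposition step for the
named fact `ReyBelletThomas2002_thm21` (provefact unit). The drift `X₀` of (RBT-SDE), RBT eq. (12),
has CONSTANT divergence `div X₀ = -2γ` (`fieldDiv_rbDrift`) and its reversal `-X₀` (friction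
`+γ r`, the couplings with their signs flipped) is again a regular confined drift for the SAME
energy `G` (the energy balance of Lemma 3.5 read with the opposite sign), so the generic
time-reversal theory applies to the transition kernels `rbKernel`:

* `OscillatorChain.rbReversedDrift` — `-X₀` as a `RegularConfinedDrift` (rates
  `K(M) = (2|Λ| + γ)M + 2γ`, `K'(M) = (2|Λ| + γ)M`); `OscillatorChain.rbRevKernel` — the
  transition kernels `P̂_t` of the reversed equation `dz = -X₀(z) dt + ∑_b v_b dB_b`;
* `OscillatorChain.trace_fderiv_rbDrift` — `tr DX₀ ≡ -2γ`;
* `OscillatorChain.rb_compProd_kernel_eq` — **duality**: `dx P_t(x, dy) = e^{2γt} dy P̂_t(y, dx)`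
  (`ConfinedDuality.lean`), with the Lebesgue-integral and Bochner forms, and
  `∫ P̂_t(y, A) dy = e^{-2γt} |A|`;
* `OscillatorChain.rb_backwardEquation` — **the Kolmogorov backward equation** for the law
  `dt dx P_t(x, dy)` tested against `Θ ∈ C_c^∞((0,∞) × X × X)`:
  `∫₀^∞ ∫ dx ∫ P_t(x,dy) (∂_tΘ + L̂_xΘ + 2γ Θ)(t, x, y) dt = 0`, `L̂` the generator of the
  reversed equation acting on `x` (`ConfinedBackwardEquation.lean`) — so that
  `Lᵀ = L̂ + 2γ` is the formal transpose of `L`;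
* `OscillatorChain.continuous_integral_rbRevKernel` — the reversed kernels are Feller.

## References

* L. Rey-Bellet, L. E. Thomas, Comm. Math. Phys. 225 (2002) 305–329, §2 eq. (12), Lemma 3.5, §4.
* U. G. Haussmann, É. Pardoux, *Time reversal of diffusions*, Ann. Probab. 14 (1986) 1188–1205.
-/

noncomputable section

open MeasureTheory ProbabilityTheory Filter Set
open scoped NNReal ENNReal ContDiff

namespace Literature.MathematicalPhysics.KineticTheory.HeatConduction

open Literature.Probability.Process Literature.Analysis.Distribution

variable {N : ℕ}

namespace OscillatorChain

variable (P : OscillatorChain)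

/-! ### The divergence of the drift as a trace -/

/-- `tr DX₀(y) = -2γ` for every `y` (the divergence of the drift of (RBT-SDE) is the constant
friction trace). [folklore] -/
theorem trace_fderiv_rbDrift (hU : ContDiff ℝ ∞ P.U) (hV : ContDiff ℝ ∞ P.V) (Λ : ℝ) (N : ℕ)
    (y : RBPhaseSpace N) :
    LinearMap.trace ℝ (RBPhaseSpace N) (fderiv ℝ (P.rbDrift Λ N) y : RBPhaseSpace N →ₗ[ℝ] RBPhaseSpace N) =
      -(2 * P.γ) :=
  P.fieldDiv_rbDrift hU hV Λ N y

/-! ### The reversed drift is a regular confined drift -/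

section Reversed

variable {P} {k₁ k₂ : ℝ} (hU : RBGrowth P.U k₁) (hV : RBGrowth P.V k₂) (hk₁ : 1 ≤ k₁) (hk₂ : 1 ≤ k₂)
  (hγ : 0 ≤ P.γ) (Λ : ℝ) (N : ℕ)

variable (P) in
/-- **The reversed drift `-X₀` of (RBT-SDE) is a regular confined drift** for the same energy `G`,
constant `c`, radius and noise subspace as `rbRegularConfinedDrift`: the upper energy balance of
`-X₀` is the lower one of `X₀` (rate `(2|Λ| + γ)M + 2γ`, the anti-friction `+γ r²` is at most
`2γ(G + c)`) and vice versa (rate `(2|Λ| + γ)M`). [cite: ReyBelletThomas2002, Lemma 3.5] -/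
def rbReversedDrift : RegularConfinedDrift (fun y => -P.rbDrift Λ N y) :=
  let D := P.rbRegularConfinedDrift hU hV hk₁ hk₂ hγ Λ N
  { V := D.V
    c := D.c
    K := D.K'
    ρ := D.ρ
    noise := D.noise
    contDiff_drift := D.contDiff_drift.neg
    differentiable_energy := D.differentiable_energy
    energy_nonneg := D.energy_nonneg
    rate_nonneg := D.rate'_nonneg
    fderiv_energy_le := fun M y e he heM => by
      rw [map_neg]
      have h := D.fderiv_energy_ge M y e he heM
      linarith
    norm_le_radius := D.norm_le_radius
    radius_mono := D.radius_mono
    K' := D.K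
    Kshift := D.Kshift
    rate_mono := D.rate'_mono
    rate'_nonneg := D.rate_nonneg
    rate'_mono := D.rate_mono
    Kshift_nonneg := D.Kshift_nonneg
    fderiv_energy_ge := fun M y e he heM => by
      rw [map_neg]
      have h := D.fderiv_energy_le M y e he heM
      linarith
    energy_shift_le := D.energy_shift_le }

/-- The noise subspace of the reversed drift is the reservoir subspace. [folklore] -/
@[simp] theorem rbReversedDrift_noise : (P.rbReversedDrift hU hV hk₁ hk₂ hγ Λ N).noise = rbNoise N := rfl

/-- The energy of the reversed drift is `G`. [folklore] -/
@[simp] theorem rbReversedDrift_V : (P.rbReversedDrift hU hV hk₁ hk₂ hγ Λ N).V = P.rbEnergy N := rfl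

end Reversed

/-! ### The reversed transition kernels -/

/-- **The transition kernels `P̂_t` of the time-reversed effective equation**
`dz = -X₀(z) dt + ∑_b v_b dB_b` (same reservoir noise). [folklore] -/
def rbRevKernel (Λ : ℝ) (N : ℕ) (T_L T_R : ℝ) (t : ℝ≥0) : Kernel (RBPhaseSpace N) (RBPhaseSpace N) :=
  sdeKernel (fun y => -P.rbDrift Λ N y) (P.rbNoiseVec N T_L T_R 0) (P.rbNoiseVec N T_L T_R 1) t

section Duality

variable {P} {k₁ k₂ : ℝ} (hU : RBGrowth P.U k₁) (hV : RBGrowth P.V k₂) (hk₁ : 1 ≤ k₁) (hk₂ : 1 ≤ k₂)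
  (hγ : 0 ≤ P.γ) (Λ : ℝ) (N : ℕ) (T_L T_R : ℝ)
include hU hV hk₁ hk₂ hγ

/-- The reversed kernels are Markov kernels. [folklore] -/
theorem isMarkovKernel_rbRevKernel (t : ℝ≥0) : IsMarkovKernel (P.rbRevKernel Λ N T_L T_R t) :=
  (P.rbReversedDrift hU hV hk₁ hk₂ hγ Λ N).toConfinedDrift.isMarkovKernel_sdeKernel
    (P.rbNoiseVec_mem N T_L T_R 0) (P.rbNoiseVec_mem N T_L T_R 1) t

/-- **The reversed kernels are Feller**: `y ↦ ∫ g dP̂_t(y, ·)` is continuous for bounded continuous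
`g`. [folklore] -/
theorem continuous_integral_rbRevKernel (t : ℝ≥0) {g : RBPhaseSpace N → ℝ} (hg : Continuous g)
    {C : ℝ} (hC : ∀ y, ‖g y‖ ≤ C) :
    Continuous fun y => ∫ x, g x ∂(P.rbRevKernel Λ N T_L T_R t y) :=
  (P.rbReversedDrift hU hV hk₁ hk₂ hγ Λ N).toConfinedDrift.continuous_integral_sdeKernel
    (P.rbNoiseVec_mem N T_L T_R 0) (P.rbNoiseVec_mem N T_L T_R 1) t hg hC

/-- **Duality of the transition kernels of (RBT-SDE) with respect to Lebesgue measure**, measure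
form: `dx P_t(x, dy) = e^{2γt} · swap_*(dy P̂_t(y, dx))` on `X × X` for `t > 0` (the drift has
divergence `-2γ`; `ConfinedDuality.lean`). [folklore] -/
theorem rb_compProd_kernel_eq {t : ℝ≥0} (ht : 0 < t) :
    (volume : Measure (RBPhaseSpace N)) ⊗ₘ P.rbKernel Λ N T_L T_R t =
      ENNReal.ofReal (Real.exp (2 * P.γ * t)) •
        ((volume : Measure (RBPhaseSpace N)) ⊗ₘ P.rbRevKernel Λ N T_L T_R t).map Prod.swap := by
  haveI := isAddHaarMeasure_volume_rbPhaseSpace N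
  have h := (P.rbConfinedDrift hU hV hk₁ hk₂ hγ Λ N).compProd_sdeKernel_eq_smul_map_swap
    (P.rbReversedDrift hU hV hk₁ hk₂ hγ Λ N).toConfinedDrift
    (P.rbNoiseVec_mem N T_L T_R 0) (P.rbNoiseVec_mem N T_L T_R 1)
    (P.rbNoiseVec_mem N T_L T_R 0) (P.rbNoiseVec_mem N T_L T_R 1) volume (fun _ => rfl)
    (P.trace_fderiv_rbDrift hU.1 hV.1 Λ N) ht
  rw [show -(-(2 * P.γ) * (t : ℝ)) = 2 * P.γ * t by ring] at h
  exact h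

/-- Duality, Lebesgue-integral form: `∫ dx ∫ P_t(x,dy) H(x,y) = e^{2γt} ∫ dy ∫ P̂_t(y,dx) H(x,y)`
for measurable `H ≥ 0`, `t > 0`. [folklore] -/
theorem rb_lintegral_kernel_duality {t : ℝ≥0} (ht : 0 < t)
    {H : RBPhaseSpace N × RBPhaseSpace N → ℝ≥0∞} (hH : Measurable H) :
    ∫⁻ x, ∫⁻ y, H (x, y) ∂(P.rbKernel Λ N T_L T_R t x) =
      ENNReal.ofReal (Real.exp (2 * P.γ * t)) *
        ∫⁻ y, ∫⁻ x, H (x, y) ∂(P.rbRevKernel Λ N T_L T_R t y) := by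
  haveI := isAddHaarMeasure_volume_rbPhaseSpace N
  have h := (P.rbConfinedDrift hU hV hk₁ hk₂ hγ Λ N).lintegral_sdeKernel_duality
    (P.rbReversedDrift hU hV hk₁ hk₂ hγ Λ N).toConfinedDrift
    (P.rbNoiseVec_mem N T_L T_R 0) (P.rbNoiseVec_mem N T_L T_R 1)
    (P.rbNoiseVec_mem N T_L T_R 0) (P.rbNoiseVec_mem N T_L T_R 1) volume (fun _ => rfl)
    (P.trace_fderiv_rbDrift hU.1 hV.1 Λ N) ht hH
  rw [show -(-(2 * P.γ) * (t : ℝ)) = 2 * P.γ * t by ring] at h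
  exact h

/-- Duality, Bochner form: for `H` integrable against `dx P_t(x, dy)`, the swapped function is
integrable against `dy P̂_t(y, dx)` and `∫ dx ∫ P_t(x,dy) H = e^{2γt} ∫ dy ∫ P̂_t(y,dx) H`.
[folklore] -/
theorem rb_integral_kernel_duality {t : ℝ≥0} (ht : 0 < t) {H : RBPhaseSpace N × RBPhaseSpace N → ℝ}
    (hH : Integrable H ((volume : Measure (RBPhaseSpace N)) ⊗ₘ P.rbKernel Λ N T_L T_R t)) :
    Integrable (fun p : RBPhaseSpace N × RBPhaseSpace N => H p.swap)
        ((volume : Measure (RBPhaseSpace N)) ⊗ₘ P.rbRevKernel Λ N T_L T_R t) ∧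
      ∫ x, ∫ y, H (x, y) ∂(P.rbKernel Λ N T_L T_R t x) =
        Real.exp (2 * P.γ * t) * ∫ y, ∫ x, H (x, y) ∂(P.rbRevKernel Λ N T_L T_R t y) := by
  haveI := isAddHaarMeasure_volume_rbPhaseSpace N
  have h := (P.rbConfinedDrift hU hV hk₁ hk₂ hγ Λ N).integral_sdeKernel_duality
    (P.rbReversedDrift hU hV hk₁ hk₂ hγ Λ N).toConfinedDrift
    (P.rbNoiseVec_mem N T_L T_R 0) (P.rbNoiseVec_mem N T_L T_R 1)
    (P.rbNoiseVec_mem N T_L T_R 0) (P.rbNoiseVec_mem N T_L T_R 1) volume (fun _ => rfl)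
    (P.trace_fderiv_rbDrift hU.1 hV.1 Λ N) ht hH
  rw [show -(-(2 * P.γ) * (t : ℝ)) = 2 * P.γ * t by ring] at h
  exact h

/-- **Lebesgue measure is an eigenmeasure of the reversed kernels**: `∫ P̂_t(y, A) dy = e^{-2γt} |A|`.
[folklore] -/
theorem rb_lintegral_revKernel_apply {t : ℝ≥0} (ht : 0 < t) {A : Set (RBPhaseSpace N)}
    (hA : MeasurableSet A) :
    ∫⁻ y, P.rbRevKernel Λ N T_L T_R t y A = ENNReal.ofReal (Real.exp (-(2 * P.γ * t))) * volume A := by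
  haveI := isAddHaarMeasure_volume_rbPhaseSpace N
  have h := (P.rbConfinedDrift hU hV hk₁ hk₂ hγ Λ N).lintegral_sdeKernel_rev_apply
    (P.rbReversedDrift hU hV hk₁ hk₂ hγ Λ N).toConfinedDrift
    (P.rbNoiseVec_mem N T_L T_R 0) (P.rbNoiseVec_mem N T_L T_R 1)
    (P.rbNoiseVec_mem N T_L T_R 0) (P.rbNoiseVec_mem N T_L T_R 1) volume (fun _ => rfl)
    (P.trace_fderiv_rbDrift hU.1 hV.1 Λ N) ht hA
  rw [show -(2 * P.γ) * (t : ℝ) = -(2 * P.γ * t) by ring] at h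
  exact h

/-- **The Kolmogorov backward equation for the law `dt dx P_t(x, dy)` of (RBT-SDE)**: for every
test function `Θ ∈ C_c^∞(ℝ × X × X)` supported in `(0, ∞) × X × X`,
`∫₀^∞ ∫ dx ∫ P_t(x, dy) (∂_tΘ + L̂₁Θ + 2γ Θ)(t, x, y) dt = 0`, where `L̂₁` is the generator of
the reversed equation acting on the first (backward) variable `x`, so that `L̂₁ + 2γ = Lᵀ₁` is the
formal transpose of the generator `L` of RBT eq. (13). [cite: ReyBelletThomas2002, §4] -/
theorem rb_backwardEquation {Θ : ℝ × (RBPhaseSpace N × RBPhaseSpace N) → ℝ} (hΘ : ContDiff ℝ ∞ Θ)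
    (hΘc : HasCompactSupport Θ) (hΘ0 : tsupport Θ ⊆ Set.Ioi (0 : ℝ) ×ˢ Set.univ) :
    ∫ t in Set.Ioi (0 : ℝ),
      pairAct (P.rbDrift Λ N) (P.rbNoiseVec N T_L T_R 0) (P.rbNoiseVec N T_L T_R 1) volume
        (fun p => fderiv ℝ Θ (t, p) (1, 0) +
          (sdeGeneratorFst (fun y => -P.rbDrift Λ N y) (P.rbNoiseVec N T_L T_R 0)
              (P.rbNoiseVec N T_L T_R 1) (fun p' => Θ (t, p')) p + 2 * P.γ * Θ (t, p)))
        t.toNNReal = 0 := by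
  haveI := isAddHaarMeasure_volume_rbPhaseSpace N
  have h := (P.rbConfinedDrift hU hV hk₁ hk₂ hγ Λ N).backwardEquation
    (P.rbNoiseVec_mem N T_L T_R 0) (P.rbNoiseVec_mem N T_L T_R 1) volume
    (P.rbReversedDrift hU hV hk₁ hk₂ hγ Λ N) (P.rbNoiseVec_mem N T_L T_R 0) (P.rbNoiseVec_mem N T_L T_R 1)
    (fun _ => rfl) (P.trace_fderiv_rbDrift hU.1 hV.1 Λ N) hΘ hΘc hΘ0
  have hfun : ∀ t : ℝ, (fun p : RBPhaseSpace N × RBPhaseSpace N => fderiv ℝ Θ (t, p) (1, 0) +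
      (sdeGeneratorFst (fun y => -P.rbDrift Λ N y) (P.rbNoiseVec N T_L T_R 0)
        (P.rbNoiseVec N T_L T_R 1) (fun p' => Θ (t, p')) p - -(2 * P.γ) * Θ (t, p))) =
      fun p => fderiv ℝ Θ (t, p) (1, 0) +
        (sdeGeneratorFst (fun y => -P.rbDrift Λ N y) (P.rbNoiseVec N T_L T_R 0)
          (P.rbNoiseVec N T_L T_R 1) (fun p' => Θ (t, p')) p + 2 * P.γ * Θ (t, p)) := by
    intro t
    funext p
    ring
  simp_rw [hfun] at h
  exact h

end Duality

end OscillatorChain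

end Literature.MathematicalPhysics.KineticTheory.HeatConduction
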